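import Literature.NumberTheory.Sieve.GreenTao2008GYExpansion
import Literature.NumberTheory.Sieve.GreenTao2008SharpGYDiagonal
import Mathlib.Analysis.SpecialFunctions.Log.PosLog
import HarnessLib

/-!
# Goldston–Yıldırım correlations, elementary route: the product model and the one-form sums

Trunk T-SIEVE. Companion of `GreenTao2008GYExpansion` for the proof of Green–Tao 2008, Prop. 9.6
(`Literature.NumberTheory.Sieve.GreenTao2008.GoldstonYildirimCorrelations`). The slots of the expanded
`m`-fold correlation are `ι = [m] ⊔ [m]` (slot `inl j` carries `d_j`, slot `inr j` carries `d'_j`);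
the MODEL local weights are those of `m` independent copies of the one-form Goldston–Yıldırım kernel,

  `κ_p(X) = ∏_j c_p([inl j ∈ X], [inr j ∈ X])`,  `c_p(x,y) = (-1)^{x+y} p^{-[x ∨ y]}`

(`= (-1)^{|X|} p^{-|idx X|}`; `kerWeight`, `pairKer`). This file proves that the model tuple sum
FACTORISES into one-form sums and identifies those with the tree's `SharpGY.diagSum`:

* `prod_pairKer_eq` — `∏_{p ∈ T} c_p(p∣a, p∣b) = μ(a)μ(b) gcd(a,b)/(ab)` for squarefree `T`-numbers;
* `tupleSum_kerWeight_eq_prod` — `T_T(κ; v ↦ log₊(R_v/·)) = ∏_j Q_T(R_{inl j}, R_{inr j})` with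
  `Q_T(R₁,R₂) = pairSumModel T R₁ R₂ = ∑_{a,b ∈ squarefreeOf T} μ(a)μ(b) gcd(a,b)/(ab) log⁺(R₁/a) log⁺(R₂/b)`
  (`log⁺ = Real.posLog`, Mathlib);
* `pairSumModel_eq_diagSum` — for `T = {p ≤ N : p ∤ q}` and `R₁, R₂ ≤ N`: `Q_T(R₁,R₂) = SharpGY.diagSum q R₁ R₂`.

## References
* B. Green, T. Tao, Ann. of Math. (2) 167 (2008), §10: (10.2) and the factor `G₃ = ∏_j ζ-ratio`
  of (10.9) (the independent-forms structure of the main term). [cite: GreenTaoAnnals2008]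
-/

noncomputable section

open Finset
open scoped BigOperators ArithmeticFunction.Moebius

namespace Literature.NumberTheory.Sieve.GreenTao2008

namespace GYCorr

/-! ### The one-pair kernel and the model local weight -/

/-- The one-pair Goldston–Yıldırım kernel at a prime: `c_p(x, y) = (-1)^{x+y} p^{-[x ∨ y]}`
(`= 1, -1/p, -1/p, 1/p`), the local factor of `μ(a)μ(b)/lcm(a,b)`.
[cite: GreenTaoAnnals2008, Section 10 eq. 10.2 (case m = 1)] -/
def pairKer (p : ℕ) (x y : Bool) : ℝ :=
  (-1) ^ (x.toNat + y.toNat) * ((p : ℝ)⁻¹) ^ (x || y).toNat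

/-- `c_p(0,0) = 1`. [folklore] -/
@[simp] theorem pairKer_false_false (p : ℕ) : pairKer p false false = 1 := by simp [pairKer]

/-- `c_p(1,0) = -1/p`. [folklore] -/
@[simp] theorem pairKer_true_false (p : ℕ) : pairKer p true false = -((p : ℝ)⁻¹) := by simp [pairKer]

/-- `c_p(0,1) = -1/p`. [folklore] -/
@[simp] theorem pairKer_false_true (p : ℕ) : pairKer p false true = -((p : ℝ)⁻¹) := by simp [pairKer]

/-- `c_p(1,1) = 1/p`. [folklore] -/
@[simp] theorem pairKer_true_true (p : ℕ) : pairKer p true true = (p : ℝ)⁻¹ := by simp [pairKer]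

/-- `|c_p(x,y)| ≤ 1` (`p ≥ 1`), and `|c_p(x,y)| ≤ 1/p` unless `x = y = 0`. [folklore] -/
theorem abs_pairKer_le {p : ℕ} (hp : 1 ≤ p) (x y : Bool) :
    |pairKer p x y| ≤ 1 ∧ ((x || y) = true → |pairKer p x y| ≤ (p : ℝ)⁻¹) := by
  have hp1 : (1 : ℝ) ≤ p := by exact_mod_cast hp
  have hinv : (p : ℝ)⁻¹ ≤ 1 := inv_le_one_of_one_le₀ hp1
  have hinv0 : 0 ≤ (p : ℝ)⁻¹ := by positivity
  cases x <;> cases y <;> simp [abs_inv, Nat.abs_cast, hinv]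

/-- **The model local weight** `κ_p(X) = ∏_j c_p([inl j ∈ X], [inr j ∈ X])` (`= (-1)^{|X|} p^{-|idx X|}`)
on patterns `X ⊆ [m] ⊔ [m]`: `m` independent copies of the one-pair kernel.
[cite: GreenTaoAnnals2008, Section 10 eq. 10.9 (the factor G₃)] -/
def kerWeight (m p : ℕ) (X : Finset (Fin m ⊕ Fin m)) : ℝ :=
  ∏ j : Fin m, pairKer p (decide (Sum.inl j ∈ X)) (decide (Sum.inr j ∈ X))

/-- `κ_p(∅) = 1`. [folklore] -/
theorem kerWeight_empty (m p : ℕ) : kerWeight m p ∅ = 1 := by simp [kerWeight]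

/-! ### `∏_{p ∈ T} c_p(p ∣ a, p ∣ b) = μ(a) μ(b) gcd(a,b)/(ab)` -/

/-- Removing the prime `p₀` from a squarefree number over `insert p₀ T`: `a = p₀^{[p₀ ∣ a]} a'` with
`a' = a/p₀^{[p₀ ∣ a]}` a squarefree `T`-number not divisible by `p₀`. [folklore] -/
theorem mem_squarefreeOf_erase {T : Finset ℕ} {p₀ : ℕ} (hT : ∀ p ∈ T, p.Prime) (hp₀ : p₀.Prime) (hp₀T : p₀ ∉ T)
    {a : ℕ} (ha : a ∈ CFZ.squarefreeOf (insert p₀ T)) :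
    (if p₀ ∣ a then a / p₀ else a) ∈ CFZ.squarefreeOf T ∧ ¬ p₀ ∣ (if p₀ ∣ a then a / p₀ else a) ∧
      a = (if p₀ ∣ a then p₀ * (if p₀ ∣ a then a / p₀ else a) else (if p₀ ∣ a then a / p₀ else a)) := by
  have hT' : ∀ p ∈ insert p₀ T, p.Prime := by
    intro p hp; rcases Finset.mem_insert.1 hp with rfl | hp; exacts [hp₀, hT p hp]
  obtain ⟨hsq, hsub⟩ := (CFZ.mem_squarefreeOf hT').1 ha
  by_cases h : p₀ ∣ a
  · simp only [if_pos h]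
    obtain ⟨k, hk⟩ := h
    have hk' : a / p₀ = k := by rw [hk, Nat.mul_div_cancel_left k hp₀.pos]
    rw [hk']
    have hsq' : Squarefree (p₀ * k) := hk ▸ hsq
    have hsqk : Squarefree k := (Nat.squarefree_mul_iff.1 hsq').2.2
    have hcop : Nat.Coprime p₀ k := (Nat.squarefree_mul_iff.1 hsq').1
    have hndk : ¬ p₀ ∣ k := (Nat.Prime.coprime_iff_not_dvd hp₀).1 hcop
    refine ⟨(CFZ.mem_squarefreeOf hT).2 ⟨hsqk, fun p hp => ?_⟩, hndk, hk⟩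
    have hpk := Nat.dvd_of_mem_primeFactors hp
    have hpp := Nat.prime_of_mem_primeFactors hp
    have hpa : p ∈ a.primeFactors := Nat.mem_primeFactors.2 ⟨hpp, hk ▸ Dvd.dvd.mul_left hpk p₀, hsq.ne_zero⟩
    rcases Finset.mem_insert.1 (hsub hpa) with rfl | hpT
    · exact absurd hpk hndk
    · exact hpT
  · simp only [if_neg h]
    refine ⟨(CFZ.mem_squarefreeOf hT).2 ⟨hsq, fun p hp => ?_⟩, h, by trivial⟩
    rcases Finset.mem_insert.1 (hsub hp) with rfl | hpT
    · exact absurd (Nat.dvd_of_mem_primeFactors hp) h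
    · exact hpT

/-- **`∏_{p ∈ T} c_p(p ∣ a, p ∣ b) = μ(a)μ(b) gcd(a,b)/(ab)`** for squarefree `a, b` built from the
primes of `T` (for squarefree numbers `gcd(a,b)/(ab) = 1/lcm(a,b)`): the local structure of the
one-form Goldston–Yıldırım kernel. [cite: GreenTaoAnnals2008, Section 10 eq. 10.2 (m = 1)] -/
theorem prod_pairKer_eq {T : Finset ℕ} (hT : ∀ p ∈ T, p.Prime) {a b : ℕ}
    (ha : a ∈ CFZ.squarefreeOf T) (hb : b ∈ CFZ.squarefreeOf T) :
    ∏ p ∈ T, pairKer p (decide (p ∣ a)) (decide (p ∣ b)) =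
      (μ a : ℝ) * (μ b : ℝ) * (Nat.gcd a b : ℝ) / ((a : ℝ) * b) := by
  classical
  induction T using Finset.induction_on generalizing a b with
  | empty =>
    rw [squarefreeOf_empty, Finset.mem_singleton] at ha hb
    subst ha; subst hb
    simp
  | insert p₀ T hp₀T ih =>
    have hp₀ : p₀.Prime := hT p₀ (Finset.mem_insert_self _ _)
    have hT0 : ∀ p ∈ T, p.Prime := fun p hp => hT p (Finset.mem_insert_of_mem hp)
    obtain ⟨ha', hna', hae⟩ := mem_squarefreeOf_erase hT0 hp₀ hp₀T ha
    obtain ⟨hb', hnb', hbe⟩ := mem_squarefreeOf_erase hT0 hp₀ hp₀T hb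
    set a' := (if p₀ ∣ a then a / p₀ else a) with ha'def
    set b' := (if p₀ ∣ b then b / p₀ else b) with hb'def
    have hih := ih hT0 ha' hb'
    have ha'0 : a' ≠ 0 := ((CFZ.mem_squarefreeOf hT0).1 ha').1.ne_zero
    have hb'0 : b' ≠ 0 := ((CFZ.mem_squarefreeOf hT0).1 hb').1.ne_zero
    have ha'R : (a' : ℝ) ≠ 0 := by exact_mod_cast ha'0
    have hb'R : (b' : ℝ) ≠ 0 := by exact_mod_cast hb'0
    have hp₀R : (p₀ : ℝ) ≠ 0 := by exact_mod_cast hp₀.ne_zero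
    have hcopa : Nat.Coprime p₀ a' := (Nat.Prime.coprime_iff_not_dvd hp₀).2 hna'
    have hcopb : Nat.Coprime p₀ b' := (Nat.Prime.coprime_iff_not_dvd hp₀).2 hnb'
    -- the factors at `p ∈ T` only see `a', b'`
    have hrest : ∏ p ∈ T, pairKer p (decide (p ∣ a)) (decide (p ∣ b)) =
        ∏ p ∈ T, pairKer p (decide (p ∣ a')) (decide (p ∣ b')) := by
      refine Finset.prod_congr rfl fun p hp => ?_
      have hpp := hT0 p hp
      have hne : p ≠ p₀ := fun h => hp₀T (h ▸ hp)
      have key : ∀ {c c' : ℕ}, ¬ p₀ ∣ c' → c = (if p₀ ∣ c then p₀ * c' else c') → (p ∣ c ↔ p ∣ c') := by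
        intro c c' _ hce
        by_cases hc : p₀ ∣ c
        · rw [hce, if_pos hc]
          constructor
          · intro h
            rcases (Nat.Prime.dvd_mul hpp).1 h with h1 | h1
            · exact absurd ((Nat.prime_dvd_prime_iff_eq hpp hp₀).1 h1) hne
            · exact h1
          · intro h; exact Dvd.dvd.mul_left h _
        · rw [hce, if_neg hc]
      rw [show decide (p ∣ a) = decide (p ∣ a') from decide_eq_decide.2 (key hna' hae),
        show decide (p ∣ b) = decide (p ∣ b') from decide_eq_decide.2 (key hnb' hbe)]
    rw [Finset.prod_insert hp₀T, hrest, hih]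
    have hμp : (μ p₀ : ℝ) = -1 := by exact_mod_cast ArithmeticFunction.moebius_apply_prime hp₀
    -- case analysis on `p₀ ∣ a`, `p₀ ∣ b`
    by_cases hpa : p₀ ∣ a <;> by_cases hpb : p₀ ∣ b
    · rw [decide_eq_true hpa, decide_eq_true hpb, pairKer_true_true]
      rw [if_pos hpa] at hae; rw [if_pos hpb] at hbe
      rw [hae, hbe]
      have hμa : (μ (p₀ * a') : ℝ) = μ p₀ * μ a' := by
        exact_mod_cast ArithmeticFunction.isMultiplicative_moebius.map_mul_of_coprime hcopa
      have hμb : (μ (p₀ * b') : ℝ) = μ p₀ * μ b' := by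
        exact_mod_cast ArithmeticFunction.isMultiplicative_moebius.map_mul_of_coprime hcopb
      rw [hμa, hμb, hμp, Nat.gcd_mul_left]
      push_cast
      field_simp
    · rw [decide_eq_true hpa, decide_eq_false hpb, pairKer_true_false]
      rw [if_pos hpa] at hae; rw [if_neg hpb] at hbe
      rw [hae, ← hbe]
      have hμa : (μ (p₀ * a') : ℝ) = μ p₀ * μ a' := by
        exact_mod_cast ArithmeticFunction.isMultiplicative_moebius.map_mul_of_coprime hcopa
      have hb'b : ¬ p₀ ∣ b := hpb
      have hcopb2 : Nat.Coprime p₀ b := (Nat.Prime.coprime_iff_not_dvd hp₀).2 hb'b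
      rw [hμa, hμp, Nat.Coprime.gcd_mul_left_cancel a' hcopb2]
      have : (b : ℝ) ≠ 0 := by rw [hbe]; exact hb'R
      rw [hbe] at this ⊢
      push_cast
      field_simp
    · rw [decide_eq_false hpa, decide_eq_true hpb, pairKer_false_true]
      rw [if_neg hpa] at hae; rw [if_pos hpb] at hbe
      rw [hbe, ← hae]
      have hμb : (μ (p₀ * b') : ℝ) = μ p₀ * μ b' := by
        exact_mod_cast ArithmeticFunction.isMultiplicative_moebius.map_mul_of_coprime hcopb
      have hcopa2 : Nat.Coprime p₀ a := (Nat.Prime.coprime_iff_not_dvd hp₀).2 hpa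
      rw [hμb, hμp, Nat.Coprime.gcd_mul_left_cancel_right b' hcopa2]
      have : (a : ℝ) ≠ 0 := by rw [hae]; exact ha'R
      rw [hae] at this ⊢
      push_cast
      field_simp
    · rw [decide_eq_false hpa, decide_eq_false hpb, pairKer_false_false, one_mul]
      rw [if_neg hpa] at hae; rw [if_neg hpb] at hbe
      rw [← hae, ← hbe]

/-! ### The factorisation of the model tuple sum -/

/-- **The one-form model sum** `Q_T(R₁,R₂) = ∑_{a,b ∈ squarefreeOf T} μ(a)μ(b) gcd(a,b)/(ab) log₊(R₁/a) log₊(R₂/b)`.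
[cite: GreenTaoAnnals2008, Section 10 eq. 10.2 (m = 1)] -/
def pairSumModel (T : Finset ℕ) (R₁ R₂ : ℝ) : ℝ :=
  ∑ a ∈ CFZ.squarefreeOf T, ∑ b ∈ CFZ.squarefreeOf T,
    (μ a : ℝ) * (μ b : ℝ) * (Nat.gcd a b : ℝ) / ((a : ℝ) * b) * Real.posLog (R₁ / a) * Real.posLog (R₂ / b)

/-- Membership in a divisibility pattern. [folklore] -/
theorem mem_pattern_iff {ι : Type*} [Fintype ι] (d : ι → ℕ) (p : ℕ) (v : ι) :
    v ∈ CFZ.pattern d p ↔ p ∣ d v := by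
  unfold CFZ.pattern; simp

/-- Tuples indexed by `[m] ⊔ [m]` are `m`-tuples of pairs. [folklore] -/
theorem sum_piFinset_sum_eq {m : ℕ} (S : Finset ℕ) (F : (Fin m ⊕ Fin m → ℕ) → ℝ) :
    ∑ d ∈ Fintype.piFinset (fun _ : Fin m ⊕ Fin m => S), F d =
      ∑ g ∈ Fintype.piFinset (fun _ : Fin m => S ×ˢ S),
        F (Sum.elim (fun j => (g j).1) (fun j => (g j).2)) := by
  classical
  symm
  refine Finset.sum_nbij' (fun g => Sum.elim (fun j => (g j).1) (fun j => (g j).2))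
    (fun d => fun j => (d (Sum.inl j), d (Sum.inr j))) ?_ ?_ ?_ ?_ ?_
  · intro g hg
    rw [Fintype.mem_piFinset] at hg ⊢
    intro v
    cases v with
    | inl j => exact (Finset.mem_product.1 (hg j)).1
    | inr j => exact (Finset.mem_product.1 (hg j)).2
  · intro d hd
    rw [Fintype.mem_piFinset] at hd ⊢
    intro j
    exact Finset.mem_product.2 ⟨hd _, hd _⟩
  · intro g _
    funext j
    simp
  · intro d _
    funext v
    cases v <;> rfl
  · intro g _
    rfl

/-- **The model tuple sum factorises into one-form sums**:
`T_T(κ; v ↦ log₊(R_v/·)) = ∏_j Q_T(R_{inl j}, R_{inr j})` ("`G₃ = ∏_j ζ(1+z_j+z'_j)/(ζ(1+z_j)ζ(1+z'_j))`",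
the independent-forms structure of the main term). [cite: GreenTaoAnnals2008, Section 10 eq. 10.9] -/
theorem tupleSum_kerWeight_eq_prod {m : ℕ} {T : Finset ℕ} (hT : ∀ p ∈ T, p.Prime)
    (Rv : Fin m ⊕ Fin m → ℝ) :
    tupleSum T (kerWeight m) (fun v d => Real.posLog (Rv v / d)) =
      ∏ j : Fin m, pairSumModel T (Rv (Sum.inl j)) (Rv (Sum.inr j)) := by
  classical
  set Φ : Fin m → ℕ → ℕ → ℝ := fun j a b =>
    (∏ p ∈ T, pairKer p (decide (p ∣ a)) (decide (p ∣ b))) * Real.posLog (Rv (Sum.inl j) / a) *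
      Real.posLog (Rv (Sum.inr j) / b) with hΦ
  -- step A: the summand as a product over `j`
  have hA : ∀ d : Fin m ⊕ Fin m → ℕ,
      (∏ p ∈ T, kerWeight m p (CFZ.pattern d p)) * ∏ v, Real.posLog (Rv v / d v) =
        ∏ j : Fin m, Φ j (d (Sum.inl j)) (d (Sum.inr j)) := by
    intro d
    have h1 : ∏ p ∈ T, kerWeight m p (CFZ.pattern d p) =
        ∏ j : Fin m, ∏ p ∈ T, pairKer p (decide (p ∣ d (Sum.inl j))) (decide (p ∣ d (Sum.inr j))) := by
      unfold kerWeight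
      rw [Finset.prod_comm]
      refine Finset.prod_congr rfl fun j _ => Finset.prod_congr rfl fun p _ => ?_
      rw [show decide (Sum.inl j ∈ CFZ.pattern d p) = decide (p ∣ d (Sum.inl j)) from
          decide_eq_decide.2 (mem_pattern_iff d p _),
        show decide (Sum.inr j ∈ CFZ.pattern d p) = decide (p ∣ d (Sum.inr j)) from
          decide_eq_decide.2 (mem_pattern_iff d p _)]
    rw [h1, Fintype.prod_sum_type, ← Finset.prod_mul_distrib, ← Finset.prod_mul_distrib]
    refine Finset.prod_congr rfl fun j _ => ?_
    rw [hΦ]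
    simp only
    ring
  unfold tupleSum
  rw [Finset.sum_congr rfl fun d _ => hA d, sum_piFinset_sum_eq]
  -- step C: product of sums
  have hC : ∑ g ∈ Fintype.piFinset (fun _ : Fin m => CFZ.squarefreeOf T ×ˢ CFZ.squarefreeOf T),
      ∏ j : Fin m, Φ j ((Sum.elim (fun j => (g j).1) (fun j => (g j).2) : Fin m ⊕ Fin m → ℕ) (Sum.inl j))
        ((Sum.elim (fun j => (g j).1) (fun j => (g j).2) : Fin m ⊕ Fin m → ℕ) (Sum.inr j)) =
      ∏ j : Fin m, ∑ x ∈ CFZ.squarefreeOf T ×ˢ CFZ.squarefreeOf T, Φ j x.1 x.2 := by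
    rw [Finset.prod_univ_sum]
    rfl
  rw [hC]
  refine Finset.prod_congr rfl fun j _ => ?_
  unfold pairSumModel
  rw [Finset.sum_product]
  refine Finset.sum_congr rfl fun a ha => Finset.sum_congr rfl fun b hb => ?_
  rw [hΦ]
  simp only
  rw [prod_pairKer_eq hT ha hb]

/-! ### Identification with `SharpGY.diagSum` -/

/-- **The one-form model sum is the tree's sharp one-form sum**: for `T = {p ≤ N : p ∤ q}` and
`0 ≤ R₁, R₂ ≤ N`, `Q_T(R₁, R₂) = S₁(q; R₁, R₂) = SharpGY.diagSum q R₁ R₂` (the squarefree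
`T`-numbers `a ≤ R₁` are exactly the squarefree `a ≤ R₁` coprime to `q`; elsewhere `μ` or `log₊`
vanishes). [cite: GreenTaoAnnals2008, Section 10 eq. 10.2 (m = 1)] -/
theorem pairSumModel_eq_diagSum {q N : ℕ} {R₁ R₂ : ℝ} (h₁0 : 0 ≤ R₁) (h₁ : R₁ ≤ N) (h₂0 : 0 ≤ R₂)
    (h₂ : R₂ ≤ N) :
    pairSumModel ((Nat.primesBelow (N + 1)).filter (fun p => ¬ p ∣ q)) R₁ R₂ = SharpGY.diagSum q R₁ R₂ := by
  classical
  set T := (Nat.primesBelow (N + 1)).filter (fun p => ¬ p ∣ q) with hTdef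
  have hT : ∀ p ∈ T, p.Prime := fun p hp => (Nat.mem_primesBelow.1 (Finset.mem_filter.1 hp).1).2
  set A : ℝ → Finset ℕ := fun R => (Finset.Icc 1 ⌊R⌋₊).filter (fun a => Squarefree a ∧ a.Coprime q) with hA
  set g : ℝ → ℝ → ℕ → ℕ → ℝ := fun R R' a b =>
    (μ a : ℝ) * (μ b : ℝ) * (Nat.gcd a b : ℝ) / ((a : ℝ) * b) * Real.posLog (R / a) * Real.posLog (R' / b) with hg
  -- `A R ⊆ squarefreeOf T` for `R ≤ N`, and `log₊` vanishes on the rest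
  have hsub : ∀ R : ℝ, 0 ≤ R → R ≤ N → A R ⊆ CFZ.squarefreeOf T := by
    intro R hR0 hR a ha
    rw [hA, Finset.mem_filter, Finset.mem_Icc] at ha
    rw [CFZ.mem_squarefreeOf hT]
    refine ⟨ha.2.1, fun p hp => ?_⟩
    have hpp := Nat.prime_of_mem_primeFactors hp
    have hpa := Nat.dvd_of_mem_primeFactors hp
    rw [hTdef, Finset.mem_filter, Nat.mem_primesBelow]
    refine ⟨⟨?_, hpp⟩, fun hpq => (Nat.Prime.coprime_iff_not_dvd hpp).1 (ha.2.2.coprime_dvd_left hpa) hpq⟩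
    have h1 : p ≤ a := Nat.le_of_dvd ha.1.1 hpa
    have h2 : (a : ℝ) ≤ N := le_trans (le_trans (by exact_mod_cast ha.1.2) (Nat.floor_le hR0)) hR
    have : a ≤ N := by exact_mod_cast h2
    omega
  have hzero : ∀ R : ℝ, 0 ≤ R → ∀ a ∈ CFZ.squarefreeOf T, a ∉ A R → Real.posLog (R / a) = 0 := by
    intro R hR a ha hna
    obtain ⟨hsq, hpf⟩ := (CFZ.mem_squarefreeOf hT).1 ha
    have ha1 : 1 ≤ a := Nat.one_le_iff_ne_zero.2 hsq.ne_zero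
    have hcop : a.Coprime q := by
      apply Nat.Coprime.symm
      rw [Nat.coprime_comm, Nat.coprime_iff_gcd_eq_one]
      by_contra hne
      obtain ⟨p, hpp, hpg⟩ := Nat.exists_prime_and_dvd hne
      have hpa : p ∣ a := hpg.trans (Nat.gcd_dvd_left a q)
      have hpq : p ∣ q := hpg.trans (Nat.gcd_dvd_right a q)
      have := hpf (Nat.mem_primeFactors.2 ⟨hpp, hpa, hsq.ne_zero⟩)
      rw [hTdef, Finset.mem_filter] at this
      exact this.2 hpq
    have hgt : ⌊R⌋₊ < a := by
      by_contra hle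
      push Not at hle
      exact hna (by rw [hA, Finset.mem_filter, Finset.mem_Icc]; exact ⟨⟨ha1, hle⟩, hsq, hcop⟩)
    have ha0 : (0 : ℝ) < a := by exact_mod_cast ha1
    have hle : R / a ≤ 1 := by
      rw [div_le_one ha0]
      exact le_trans (Nat.lt_floor_add_one R).le (by exact_mod_cast hgt)
    exact (Real.posLog_eq_zero_iff _).2 (abs_le.2 ⟨by linarith [div_nonneg hR ha0.le], hle⟩)
  -- the model sum over `A R₁ × A R₂`
  have hmodel : pairSumModel T R₁ R₂ = ∑ a ∈ A R₁, ∑ b ∈ A R₂, g R₁ R₂ a b := by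
    unfold pairSumModel
    rw [← Finset.sum_subset (hsub R₁ h₁0 h₁)]
    · refine Finset.sum_congr rfl fun a _ => ?_
      rw [← Finset.sum_subset (hsub R₂ h₂0 h₂)]
      intro b hb hnb
      simp only [hzero R₂ h₂0 b hb hnb, mul_zero]
    · intro a ha hna
      refine Finset.sum_eq_zero fun b _ => ?_
      simp only [hzero R₁ h₁0 a ha hna, mul_zero, zero_mul]
  -- the sharp sum over `A R₁ × A R₂`
  have hsubA : ∀ R : ℝ, A R ⊆ (Finset.Icc 1 ⌊R⌋₊).filter (fun a => a.Coprime q) := by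
    intro R a ha
    rw [hA, Finset.mem_filter] at ha
    rw [Finset.mem_filter]
    exact ⟨ha.1, ha.2.2⟩
  have hμ0 : ∀ R : ℝ, ∀ a ∈ (Finset.Icc 1 ⌊R⌋₊).filter (fun a => a.Coprime q), a ∉ A R → (μ a : ℝ) = 0 := by
    intro R a ha hna
    rw [Finset.mem_filter] at ha
    have hnsq : ¬Squarefree a := fun hsq => hna (by rw [hA, Finset.mem_filter]; exact ⟨ha.1, hsq, ha.2⟩)
    exact_mod_cast ArithmeticFunction.moebius_eq_zero_of_not_squarefree hnsq
  have hsharp : SharpGY.diagSum q R₁ R₂ = ∑ a ∈ A R₁, ∑ b ∈ A R₂,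
      (μ a : ℝ) / a * Real.log (R₁ / a) * ((μ b : ℝ) / b * Real.log (R₂ / b)) * (Nat.gcd a b : ℝ) := by
    unfold SharpGY.diagSum
    rw [← Finset.sum_subset (hsubA R₁)]
    · refine Finset.sum_congr rfl fun a _ => ?_
      rw [← Finset.sum_subset (hsubA R₂)]
      intro b hb hnb
      rw [hμ0 R₂ b hb hnb]; ring
    · intro a ha hna
      refine Finset.sum_eq_zero fun b _ => ?_
      rw [hμ0 R₁ a ha hna]; ring
  rw [hmodel, hsharp]
  refine Finset.sum_congr rfl fun a ha => Finset.sum_congr rfl fun b hb => ?_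
  rw [hA, Finset.mem_filter, Finset.mem_Icc] at ha hb
  have ha0 : (0 : ℝ) < a := by exact_mod_cast ha.1.1
  have hb0 : (0 : ℝ) < b := by exact_mod_cast hb.1.1
  have hRa : 1 ≤ R₁ / a := by
    rw [le_div_iff₀ ha0, one_mul]
    exact le_trans (by exact_mod_cast ha.1.2) (Nat.floor_le h₁0)
  have hRb : 1 ≤ R₂ / b := by
    rw [le_div_iff₀ hb0, one_mul]
    exact le_trans (by exact_mod_cast hb.1.2) (Nat.floor_le h₂0)
  simp only [hg, Real.posLog_eq_log (le_abs.2 (Or.inl hRa)), Real.posLog_eq_log (le_abs.2 (Or.inl hRb))]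
  field_simp

end GYCorr

end Literature.NumberTheory.Sieve.GreenTao2008
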